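/-
Copyright (c) 2026. Released under Apache 2.0 license.
-/
import Literature.NumberTheory.Automorphic.UnboundedDenominatorsInvariantHomPrimeSquare
import Literature.NumberTheory.Automorphic.UnboundedDenominatorsLayerCoordinatesMul
import Literature.NumberTheory.Automorphic.UnboundedDenominatorsPowCommutator
import Literature.NumberTheory.Automorphic.UnboundedDenominatorsInvariantHomCrossCommutator
import HarnessLib

/-!
# The invariant form of CDT Cor. 4.5.3 at depth `e ≥ 2`: the top layer is central under `Γ(p)`

Let `p` be an odd prime, `gcd(m', p) = 1`, `N = m'p^{n+2}` and `θ : Γ(N) → Q` an `SL₂(ℤ)`-conjugation-invariant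
homomorphism of `p`-power exponent; `K_θ` the image of `ker θ`, `G = SL₂(ℤ)/K_θ`.  **Then `θ` kills every
commutator `[x, y]` with `x ∈ Γ(p)` and `y ∈ Γ(m'p^{n+1})`** (`map_commutatorElement_layer_eq_one`): in `G`, the
image `Â` of `Γ(m'p^{n+1})` (the top layer `𝔰𝔩₂(𝔽_p)` over the centre) is centralised by the image of `Γ(p)`; in
particular `Â` is abelian.  This is the first step of the layer analysis of the Schur multiplier of
`SL₂(ℤ/p^e)` at `p` for `e ≥ 3` ([Beyl1986]); for `e = 2` it re-proves the abelianness step of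
`UnboundedDenominatorsInvariantHomPrimeSquare`.

Proof: `u ↦ [û, ŷ]` (`y` in the top layer) is a homomorphism on the image of `Γ(p)` with central `p`-torsion
values; the layer generators `T^{m'p^j}`, `S T^{m'p^j} S⁻¹`, `T S T^{m'p^j} S⁻¹ T⁻¹` are exact `p`-th powers of
those one layer up, so by the layer normal forms everything reduces to layer `1` against the top layer, where
the pairing `c_{j,k} = [T̂^{m'p^j}, Ŝ T̂^{m'p^k} Ŝ⁻¹]` (`j + k = n+2`) is independent of `j` (power-shifting with
central `p`-torsion double commutators) and inverted by conjugation by `S` (`S² = -1`), hence trivial (odd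
order).  [cite: CalegariDimitrovTang2025, Corollary 4.5.3] [cite: Beyl1986, Theorem]
-/

open scoped MatrixGroups commutatorElement

namespace Literature.NumberTheory.Automorphic

namespace UnboundedDenominators

open CongruenceSubgroup Matrix.SpecialLinearGroup ModularGroup

variable {Q : Type*} [CommGroup Q]

/-- `Γ(L) ≤ Γ(M)` for `M ∣ L`. [folklore] -/
private theorem Gamma_le_Gamma_of_dvd₁₀ {M L : ℕ} (h : M ∣ L) : Gamma L ≤ Gamma M := by
  intro γ hγ
  obtain ⟨h00, h01, h10, h11⟩ := Gamma_mem.mp hγ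
  have cast_eq : ∀ a : ℤ, ((a : ZMod L).cast : ZMod M) = (a : ZMod M) := fun a ↦
    ZMod.cast_intCast h a
  rw [Gamma_mem]
  refine ⟨?_, ?_, ?_, ?_⟩
  · rw [← cast_eq, h00, ZMod.cast_one h]
  · rw [← cast_eq, h01, ZMod.cast_zero]
  · rw [← cast_eq, h10, ZMod.cast_zero]
  · rw [← cast_eq, h11, ZMod.cast_one h]

/-- `S² = -1` is central in `SL₂(ℤ)`. [folklore] -/
private theorem S_mul_S_comm' (g : SL(2, ℤ)) : S * S * g = g * (S * S) := by
  have hS2 : (S : Matrix (Fin 2) (Fin 2) ℤ) * (S : Matrix (Fin 2) (Fin 2) ℤ) = -1 := by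
    rw [coe_S]
    ext i j
    fin_cases i <;> fin_cases j <;> simp [Matrix.mul_apply, Fin.sum_univ_two]
  apply Subtype.ext
  simp only [Matrix.SpecialLinearGroup.coe_mul]
  rw [hS2, neg_one_mul, mul_neg_one]

/-- `T^M ∈ Γ(M)`. [folklore] -/
private theorem T_pow_mem_Gamma' (M : ℕ) : T ^ M ∈ Gamma M := by
  have := ModularGroup_T_pow_mem_Gamma (M : ℤ) (M : ℤ) (dvd_refl _)
  rwa [zpow_natCast, Int.natAbs_natCast] at this

/-- **The top layer is centralised by `Γ(p)`.**  For an odd prime `p`, `gcd(m', p) = 1` and an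
`SL₂(ℤ)`-conjugation-invariant `θ : Γ(m'p^{n+2}) → Q` of `p`-power exponent, `θ([x, y]) = 1` for all `x ∈ Γ(p)`
and `y ∈ Γ(m'p^{n+1})`. [cite: CalegariDimitrovTang2025, Corollary 4.5.3] [cite: Beyl1986, Theorem] -/
theorem map_commutatorElement_layer_eq_one {p m' n a : ℕ} (hp : p.Prime) (hp2 : p ≠ 2) [NeZero m']
    (hmm : m'.Coprime p) (θ : Gamma (m' * p ^ (n + 2)) →* Q)
    (hθ : ∀ (g x : SL(2, ℤ)) (hx : x ∈ Gamma (m' * p ^ (n + 2))) (hgx : g * x * g⁻¹ ∈ Gamma (m' * p ^ (n + 2))),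
      θ ⟨g * x * g⁻¹, hgx⟩ = θ ⟨x, hx⟩)
    (he : ∀ x : Gamma (m' * p ^ (n + 2)), θ x ^ (p ^ a) = 1) {x y : SL(2, ℤ)} (hx : x ∈ Gamma p)
    (hy : y ∈ Gamma (m' * p ^ (n + 1))) (hxy : ⁅x, y⁆ ∈ Gamma (m' * p ^ (n + 2))) :
    θ ⟨⁅x, y⁆, hxy⟩ = 1 := by
  classical
  haveI : Fact p.Prime := ⟨hp⟩
  haveI : NeZero p := ⟨hp.ne_zero⟩
  haveI : NeZero (p ^ (n + 2)) := ⟨pow_ne_zero _ hp.ne_zero⟩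
  haveI := ker_map_subtype_normal θ hθ
  have hm0 : m' ≠ 0 := NeZero.ne m'
  set K : Subgroup SL(2, ℤ) := θ.ker.map (Gamma (m' * p ^ (n + 2))).subtype with hKdef
  set π : SL(2, ℤ) →* SL(2, ℤ) ⧸ K := QuotientGroup.mk' K with hπ
  -- the congruence subgroups `Γ_j = Γ(m' p^j)`
  have hΓmono : ∀ {i j : ℕ}, i ≤ j → Gamma (m' * p ^ j) ≤ Gamma (m' * p ^ i) := fun {i j} hij ↦
    Gamma_le_Gamma_of_dvd₁₀ (mul_dvd_mul_left m' (pow_dvd_pow p hij))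
  have hΓp : ∀ {j : ℕ}, 1 ≤ j → Gamma (m' * p ^ j) ≤ Gamma p := fun {j} hj ↦
    Gamma_le_Gamma_of_dvd₁₀ (Dvd.dvd.mul_left (dvd_pow_self p (by omega)) m')
  have hΓm' : ∀ j : ℕ, Gamma (m' * p ^ j) ≤ Gamma m' := fun j ↦ Gamma_le_Gamma_of_dvd₁₀ (dvd_mul_right m' _)
  haveI : ∀ j : ℕ, (Gamma (m' * p ^ j)).Normal := fun j ↦ Gamma_normal _
  haveI := Gamma_normal p
  -- commutators of `Γ(p)` with the top layer land in `Γ(N)`, those of layers `i`, `j` (`i + j = n+1`) in the top layer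
  have hcommN : ∀ {u v : SL(2, ℤ)}, u ∈ Gamma p → v ∈ Gamma (m' * p ^ (n + 1)) →
      ⁅u, v⁆ ∈ Gamma (m' * p ^ (n + 2)) := fun {u v} hu hv ↦
    Gamma_le_Gamma_of_dvd₁₀ ⟨1, by ring⟩ (commutatorElement_mem_Gamma_mul_of_mem hu hv)
  have hcommA : ∀ {i j : ℕ} {u v : SL(2, ℤ)}, i + j = n + 1 → u ∈ Gamma (m' * p ^ i) →
      v ∈ Gamma (m' * p ^ j) → ⁅u, v⁆ ∈ Gamma (m' * p ^ (n + 1)) := by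
    intro i j u v hij hu hv
    refine Gamma_le_Gamma_of_dvd₁₀ ⟨m', ?_⟩ (commutatorElement_mem_Gamma_mul_of_mem hu hv)
    rw [← hij, pow_add]; ring
  -- the quotient
  have hπone : ∀ (w : SL(2, ℤ)) (hw : w ∈ Gamma (m' * p ^ (n + 2))), π w = 1 → θ ⟨w, hw⟩ = 1 := by
    intro w hw h1
    rw [hπ, QuotientGroup.mk'_apply, QuotientGroup.eq_one_iff] at h1
    obtain ⟨_, h⟩ := (mem_ker_map_subtype_iff θ).mp h1
    exact h
  have hπpow : ∀ w : SL(2, ℤ), w ∈ Gamma (m' * p ^ (n + 2)) → (π w) ^ (p ^ a) = 1 := by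
    intro w hw
    rw [← map_pow, hπ, QuotientGroup.mk'_apply, QuotientGroup.eq_one_iff]
    refine (mem_ker_map_subtype_iff θ).mpr ⟨pow_mem hw _, ?_⟩
    have h1 : (⟨w ^ p ^ a, pow_mem hw _⟩ : Gamma (m' * p ^ (n + 2))) = ⟨w, hw⟩ ^ (p ^ a) := rfl
    rw [h1, map_pow, he]
  have hcentralN : ∀ w ∈ Gamma (m' * p ^ (n + 2)), ∀ g : SL(2, ℤ) ⧸ K, ⁅g, π w⁆ = 1 ∧ ⁅π w, g⁆ = 1 := by
    intro w hw g
    have hc' : π w ∈ Subgroup.center (SL(2, ℤ) ⧸ K) := mk_mem_center_of_mem_Gamma θ hθ hw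
    have hc := Subgroup.mem_center_iff.mp hc'
    constructor
    · rw [commutatorElement_def, hc g]; group
    · rw [commutatorElement_def, ← hc g]; group
  have hcent : ∀ {u v : SL(2, ℤ)}, u ∈ Gamma p → v ∈ Gamma (m' * p ^ (n + 1)) →
      ⁅π u, π v⁆ ∈ Subgroup.center (SL(2, ℤ) ⧸ K) := fun {u v} hu hv ↦ by
    rw [← map_commutatorElement]
    exact (mk_mem_center_of_mem_Gamma θ hθ (hcommN hu hv) : π ⁅u, v⁆ ∈ Subgroup.center (SL(2, ℤ) ⧸ K))
  -- the right homomorphism `v ↦ [û, v̂]` on the top layer and `p`-torsion of the values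
  have hRmul : ∀ {u v v' : SL(2, ℤ)}, u ∈ Gamma p → v ∈ Gamma (m' * p ^ (n + 1)) →
      v' ∈ Gamma (m' * p ^ (n + 1)) → ⁅π u, π (v * v')⁆ = ⁅π u, π v⁆ * ⁅π u, π v'⁆ := by
    intro u v v' hu hv hv'
    have hc := Subgroup.mem_center_iff.mp (hcent hu hv')
    rw [map_mul, show ⁅π u, π v * π v'⁆ = ⁅π u, π v⁆ * (π v * ⁅π u, π v'⁆ * (π v)⁻¹) by
      simp only [commutatorElement_def]; group, hc (π v), mul_inv_cancel_right]
  have hptors : ∀ {u v : SL(2, ℤ)}, u ∈ Gamma p → v ∈ Gamma (m' * p ^ (n + 1)) → ⁅π u, π v⁆ ^ p = 1 := by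
    intro u v hu hv
    -- `[û, v̂]^p = [û, v̂^p]` and `v^p ∈ Γ(N)`
    have hvp : v ^ p ∈ Gamma (m' * p ^ (n + 2)) := by
      have h := pow_mem_Gamma_mul_of_dvd (Dvd.dvd.mul_left (dvd_pow_self p (by omega : n + 1 ≠ 0)) m') hv
      rwa [show m' * p ^ (n + 1) * p = m' * p ^ (n + 2) by ring] at h
    have key : ∀ k : ℕ, ⁅π u, π (v ^ k)⁆ = ⁅π u, π v⁆ ^ k := by
      intro k
      induction k with
      | zero => simp
      | succ k ih => rw [pow_succ, hRmul hu (pow_mem hv k) hv, ih, pow_succ]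
    rw [← key p]
    exact (hcentralN _ hvp (π u)).1
  -- the left homomorphism `u ↦ [û, v̂]` on the image of `Γ(p)`
  have hLmul : ∀ {u u' v : SL(2, ℤ)}, u ∈ Gamma p → u' ∈ Gamma p → v ∈ Gamma (m' * p ^ (n + 1)) →
      ⁅π (u * u'), π v⁆ = ⁅π u, π v⁆ * ⁅π u', π v⁆ := by
    intro u u' v hu hu' hv
    have hc := Subgroup.mem_center_iff.mp (hcent hu' hv)
    have hc' := Subgroup.mem_center_iff.mp (hcent hu hv)
    rw [map_mul, show ⁅π u * π u', π v⁆ = π u * ⁅π u', π v⁆ * (π u)⁻¹ * ⁅π u, π v⁆ by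
      simp only [commutatorElement_def]; group, hc (π u), mul_inv_cancel_right]
    exact hc' _
  have hLpow : ∀ {u v : SL(2, ℤ)}, u ∈ Gamma p → v ∈ Gamma (m' * p ^ (n + 1)) →
      ∀ k : ℕ, ⁅π (u ^ k), π v⁆ = ⁅π u, π v⁆ ^ k := by
    intro u v hu hv k
    induction k with
    | zero => simp
    | succ k ih => rw [pow_succ, hLmul (pow_mem hu k) hu hv, ih, pow_succ]
  have hLzpow : ∀ {u v : SL(2, ℤ)}, u ∈ Gamma p → v ∈ Gamma (m' * p ^ (n + 1)) →
      ∀ k : ℤ, ⁅π (u ^ k), π v⁆ = ⁅π u, π v⁆ ^ k := by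
    intro u v hu hv k
    rcases Int.eq_nat_or_neg k with ⟨l, rfl | rfl⟩
    · rw [zpow_natCast, zpow_natCast, hLpow hu hv]
    · rw [zpow_neg, zpow_natCast, zpow_neg, zpow_natCast, ← hLpow hu hv]
      have h1 := hLmul (inv_mem (pow_mem hu l)) (pow_mem hu l) hv
      rw [inv_mul_cancel, map_one, commutatorElement_one_left] at h1
      exact eq_inv_of_mul_eq_one_left h1.symm
  have hRzpow : ∀ {u v : SL(2, ℤ)}, u ∈ Gamma p → v ∈ Gamma (m' * p ^ (n + 1)) →
      ∀ k : ℤ, ⁅π u, π (v ^ k)⁆ = ⁅π u, π v⁆ ^ k := by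
    intro u v hu hv k
    have hR : ∀ l : ℕ, ⁅π u, π (v ^ l)⁆ = ⁅π u, π v⁆ ^ l := by
      intro l
      induction l with
      | zero => simp
      | succ l ih => rw [pow_succ, hRmul hu (pow_mem hv l) hv, ih, pow_succ]
    rcases Int.eq_nat_or_neg k with ⟨l, rfl | rfl⟩
    · rw [zpow_natCast, zpow_natCast, hR]
    · rw [zpow_neg, zpow_natCast, zpow_neg, zpow_natCast, ← hR]
      have h1 := hRmul hu (inv_mem (pow_mem hv l)) (pow_mem hv l)
      rw [inv_mul_cancel, map_one, commutatorElement_one_right] at h1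
      exact eq_inv_of_mul_eq_one_left h1.symm
  -- generators of the layers: `a₀ = T^{m'}`, `b₀ = S a₀ S⁻¹`; layer `j`: `a₀^{p^j}`, `b₀^{p^j}`, `T b₀^{p^j} T⁻¹`
  set a₀ : SL(2, ℤ) := T ^ m' with ha₀
  set b₀ : SL(2, ℤ) := S * a₀ * S⁻¹ with hb₀
  have ha₀m : a₀ ∈ Gamma m' := T_pow_mem_Gamma' m'
  have huE : ∀ j : ℕ, a₀ ^ p ^ j = T ^ (m' * p ^ j) := fun j ↦ by rw [ha₀, ← pow_mul]
  have huF : ∀ j : ℕ, b₀ ^ p ^ j = S * T ^ (m' * p ^ j) * S⁻¹ := fun j ↦ by rw [hb₀, conj_pow, huE]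
  have hSa : ∀ j : ℕ, S * a₀ ^ p ^ j * S⁻¹ = b₀ ^ p ^ j := fun j ↦ by rw [hb₀, conj_pow]
  have hSb : ∀ j : ℕ, S * b₀ ^ p ^ j * S⁻¹ = a₀ ^ p ^ j := fun j ↦ by
    rw [hb₀, conj_pow, show S * (S * a₀ ^ p ^ j * S⁻¹) * S⁻¹ = S * S * a₀ ^ p ^ j * (S * S)⁻¹ by group,
      S_mul_S_comm' (a₀ ^ p ^ j), mul_inv_cancel_right]
  have hTa : ∀ j : ℕ, T * a₀ ^ p ^ j * T⁻¹ = a₀ ^ p ^ j := fun j ↦ by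
    rw [(((Commute.refl T).pow_right m').pow_right (p ^ j)).eq, mul_inv_cancel_right]
  have hEmem : ∀ j : ℕ, a₀ ^ p ^ j ∈ Gamma (m' * p ^ j) := fun j ↦ by rw [huE]; exact T_pow_mem_Gamma' _
  have hFmem : ∀ j : ℕ, b₀ ^ p ^ j ∈ Gamma (m' * p ^ j) := fun j ↦ by
    rw [← hSa]; exact (Gamma_normal _).conj_mem _ (hEmem j) S
  have hHmem : ∀ j : ℕ, T * b₀ ^ p ^ j * T⁻¹ ∈ Gamma (m' * p ^ j) := fun j ↦
    (Gamma_normal _).conj_mem _ (hFmem j) T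
  have hEpow : ∀ j : ℕ, a₀ ^ p ^ (j + 1) = (a₀ ^ p ^ j) ^ p := fun j ↦ by rw [pow_succ, pow_mul]
  have hFpow : ∀ j : ℕ, b₀ ^ p ^ (j + 1) = (b₀ ^ p ^ j) ^ p := fun j ↦ by rw [pow_succ, pow_mul]
  have hHpow : ∀ j : ℕ, T * b₀ ^ p ^ (j + 1) * T⁻¹ = (T * b₀ ^ p ^ j * T⁻¹) ^ p := fun j ↦ by
    rw [hFpow]; exact conj_pow.symm
  -- entries of `T`
  have t00 : ((T : SL(2, ℤ)) 0 0 : ℤ) = 1 := by simp [coe_T]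
  have t01 : ((T : SL(2, ℤ)) 0 1 : ℤ) = 1 := by simp [coe_T]
  have t10 : ((T : SL(2, ℤ)) 1 0 : ℤ) = 0 := by simp [coe_T]
  have t11 : ((T : SL(2, ℤ)) 1 1 : ℤ) = 1 := by simp [coe_T]
  -- normal form of layer `j ≥ 1`
  have hNF : ∀ j : ℕ, 1 ≤ j → ∀ u ∈ Gamma (m' * p ^ j), ∃ (i k l : ℤ) (γ : SL(2, ℤ)),
      γ ∈ Gamma (m' * p ^ (j + 1)) ∧
      u = γ * ((T * b₀ ^ p ^ j * T⁻¹) ^ i * (a₀ ^ p ^ j) ^ k * (b₀ ^ p ^ j) ^ l) := by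
    intro j hj u hu
    have hq : m' * p ^ j ≠ 0 := Nat.mul_ne_zero hm0 (pow_ne_zero _ hp.ne_zero)
    have hpq : p ∣ m' * p ^ j := Dvd.dvd.mul_left (dvd_pow_self p (by omega)) m'
    obtain ⟨Φ, -, -, -, P4, P5, P6, P7⟩ := exists_layerCoord_mul (m' * p ^ j) p hq hpq
    have hTq : T ^ (m' * p ^ j) ∈ Gamma (m' * p ^ j) := T_pow_mem_Gamma' _
    have hSTq : S * T ^ (m' * p ^ j) * S⁻¹ ∈ Gamma (m' * p ^ j) := (Gamma_normal _).conj_mem _ hTq S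
    have hE : Φ ⟨a₀ ^ p ^ j, hEmem j⟩ = Multiplicative.ofAdd (0, 1, 0) := by
      rw [show (⟨a₀ ^ p ^ j, hEmem j⟩ : Gamma (m' * p ^ j)) = ⟨T ^ (m' * p ^ j), hTq⟩ from
        Subtype.ext (huE j)]
      exact P5 hTq
    have hF : Φ ⟨b₀ ^ p ^ j, hFmem j⟩ = Multiplicative.ofAdd (0, 0, -1) := by
      rw [show (⟨b₀ ^ p ^ j, hFmem j⟩ : Gamma (m' * p ^ j)) = ⟨S * T ^ (m' * p ^ j) * S⁻¹, hSTq⟩ from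
        Subtype.ext (huF j)]
      exact P6 hSTq
    have hH : Φ ⟨T * b₀ ^ p ^ j * T⁻¹, hHmem j⟩ = Multiplicative.ofAdd (-1, 1, -1) := by
      refine (P4 T (b₀ ^ p ^ j) (hFmem j) (hHmem j) 0 0 (-1) hF).trans ?_
      rw [t00, t01, t10, t11]
      push_cast
      congr 1
      norm_num
    obtain ⟨i, k, l, hmem⟩ := P7 _ _ _ (hHmem j) (hEmem j) (hFmem j) hH hE hF u hu
    refine ⟨i, k, l, u * ((T * b₀ ^ p ^ j * T⁻¹) ^ i * (a₀ ^ p ^ j) ^ k * (b₀ ^ p ^ j) ^ l)⁻¹, ?_, by group⟩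
    exact Gamma_le_Gamma_of_dvd₁₀ ⟨1, by ring⟩ hmem
  -- (5) the chain `c_{j,k}` is constant
  have hchain : ∀ j k : ℕ, 1 ≤ j → 1 ≤ k → j + k = n + 2 →
      ⁅π (a₀ ^ p ^ j), π (b₀ ^ p ^ k)⁆ = ⁅π (a₀ ^ p ^ 1), π (b₀ ^ p ^ (n + 1))⁆ := by
    intro j
    induction j with
    | zero => intro k hj; omega
    | succ j ih =>
      intro k hj1 hk hjk
      rcases Nat.eq_zero_or_pos j with rfl | hjpos
      · have hk' : k = n + 1 := by omega
        subst hk'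
        rfl
      · have hA : a₀ ^ p ^ j ∈ Gamma p := hΓp hjpos (hEmem j)
        have hB : b₀ ^ p ^ k ∈ Gamma p := hΓp hk (hFmem k)
        have hAB : ⁅a₀ ^ p ^ j, b₀ ^ p ^ k⁆ ∈ Gamma (m' * p ^ (n + 1)) :=
          hcommA (by omega) (hEmem j) (hFmem k)
        have hz : ⁅π (a₀ ^ p ^ j), ⁅π (a₀ ^ p ^ j), π (b₀ ^ p ^ k)⁆⁆ ∈ Subgroup.center (SL(2, ℤ) ⧸ K) := by
          rw [← map_commutatorElement π (a₀ ^ p ^ j) (b₀ ^ p ^ k)]; exact hcent hA hAB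
        have hzp : ⁅π (a₀ ^ p ^ j), ⁅π (a₀ ^ p ^ j), π (b₀ ^ p ^ k)⁆⁆ ^ p = 1 := by
          rw [← map_commutatorElement π (a₀ ^ p ^ j) (b₀ ^ p ^ k)]; exact hptors hA hAB
        have hz' : ⁅π (b₀ ^ p ^ k), ⁅π (a₀ ^ p ^ j), π (b₀ ^ p ^ k)⁆⁆ ∈ Subgroup.center (SL(2, ℤ) ⧸ K) := by
          rw [← map_commutatorElement π (a₀ ^ p ^ j) (b₀ ^ p ^ k)]; exact hcent hB hAB
        have hzp' : ⁅π (b₀ ^ p ^ k), ⁅π (a₀ ^ p ^ j), π (b₀ ^ p ^ k)⁆⁆ ^ p = 1 := by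
          rw [← map_commutatorElement π (a₀ ^ p ^ j) (b₀ ^ p ^ k)]; exact hptors hB hAB
        have h1 := commutatorElement_pow_left_eq hp hp2 (π (a₀ ^ p ^ j)) (π (b₀ ^ p ^ k)) hz hzp
        have h2 := commutatorElement_pow_right_eq hp hp2 (π (a₀ ^ p ^ j)) (π (b₀ ^ p ^ k)) hz' hzp'
        calc ⁅π (a₀ ^ p ^ (j + 1)), π (b₀ ^ p ^ k)⁆
            = ⁅π (a₀ ^ p ^ j) ^ p, π (b₀ ^ p ^ k)⁆ := by rw [hEpow, map_pow]
          _ = ⁅π (a₀ ^ p ^ j), π (b₀ ^ p ^ k)⁆ ^ p := h1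
          _ = ⁅π (a₀ ^ p ^ j), π (b₀ ^ p ^ k) ^ p⁆ := h2.symm
          _ = ⁅π (a₀ ^ p ^ j), π (b₀ ^ p ^ (k + 1))⁆ := by rw [← map_pow, ← hFpow]
          _ = _ := ih (k + 1) hjpos (by omega) (by omega)
  -- the value `c₀ = [π a₀^p, π b₀^{p^{n+1}}]` is trivial
  have hu1 : a₀ ^ p ^ 1 ∈ Gamma p := hΓp le_rfl (hEmem 1)
  have hc0 : ⁅π (a₀ ^ p ^ 1), π (b₀ ^ p ^ (n + 1))⁆ = 1 := by
    set c₀ := ⁅π (a₀ ^ p ^ 1), π (b₀ ^ p ^ (n + 1))⁆ with hc₀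
    have hlast : ⁅π (a₀ ^ p ^ (n + 1)), π (b₀ ^ p ^ 1)⁆ = c₀ := hchain (n + 1) 1 (by omega) le_rfl (by omega)
    have hcent₀ := Subgroup.mem_center_iff.mp (hcent hu1 (hFmem (n + 1)))
    have h1 : π S * c₀ * (π S)⁻¹ = c₀⁻¹ := by
      calc π S * c₀ * (π S)⁻¹ = ⁅π (S * a₀ ^ p ^ 1 * S⁻¹), π (S * b₀ ^ p ^ (n + 1) * S⁻¹)⁆ := by
            rw [hc₀]; simp only [map_mul, map_inv, commutatorElement_def]; group
        _ = ⁅π (b₀ ^ p ^ 1), π (a₀ ^ p ^ (n + 1))⁆ := by rw [hSa, hSb]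
        _ = (⁅π (a₀ ^ p ^ (n + 1)), π (b₀ ^ p ^ 1)⁆)⁻¹ := by rw [commutatorElement_inv]
        _ = c₀⁻¹ := by rw [hlast]
    have h2 : π S * c₀ * (π S)⁻¹ = c₀ := by rw [hcent₀ (π S), mul_inv_cancel_right]
    have h3 : c₀⁻¹ = c₀ := h1.symm.trans h2
    have hsq : c₀ ^ 2 = 1 := by
      rw [pow_two]
      nth_rw 1 [← h3]
      exact inv_mul_cancel _
    have hpa : c₀ ^ (p ^ a) = 1 := by
      rw [hc₀, ← map_commutatorElement]
      exact hπpow _ (hcommN hu1 (hFmem (n + 1)))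
    have cop2 : Nat.Coprime 2 (p ^ a) :=
      Nat.Coprime.pow_right a ((Nat.coprime_primes Nat.prime_two hp).mpr hp2.symm)
    have h := pow_gcd_eq_one.mpr ⟨hsq, hpa⟩
    rwa [Nat.Coprime.gcd_eq_one cop2, pow_one] at h
  -- (6) `[π a₀^p, ·]` kills the top layer
  have hE1 : ∀ v ∈ Gamma (m' * p ^ (n + 1)), ⁅π (a₀ ^ p ^ 1), π v⁆ = 1 := by
    intro v hv
    obtain ⟨i, k, l, γ, hγ, hveq⟩ := hNF (n + 1) (by omega) v hv
    have hγ' : γ ∈ Gamma (m' * p ^ (n + 1)) := hΓmono (by omega) hγ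
    have m1 : (T * b₀ ^ p ^ (n + 1) * T⁻¹) ^ i ∈ Gamma (m' * p ^ (n + 1)) := zpow_mem (hHmem _) i
    have m2 : (a₀ ^ p ^ (n + 1)) ^ k ∈ Gamma (m' * p ^ (n + 1)) := zpow_mem (hEmem _) k
    have m3 : (b₀ ^ p ^ (n + 1)) ^ l ∈ Gamma (m' * p ^ (n + 1)) := zpow_mem (hFmem _) l
    have vE : ⁅π (a₀ ^ p ^ 1), π (a₀ ^ p ^ (n + 1))⁆ = 1 := by
      rw [← map_commutatorElement, commutatorElement_eq_one_iff_mul_comm.mpr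
        (((Commute.refl a₀).pow_left (p ^ 1)).pow_right (p ^ (n + 1))).eq, map_one]
    have vH : ⁅π (a₀ ^ p ^ 1), π (T * b₀ ^ p ^ (n + 1) * T⁻¹)⁆ = 1 := by
      calc ⁅π (a₀ ^ p ^ 1), π (T * b₀ ^ p ^ (n + 1) * T⁻¹)⁆
          = π T * ⁅π (T⁻¹ * a₀ ^ p ^ 1 * T), π (b₀ ^ p ^ (n + 1))⁆ * (π T)⁻¹ := by
            simp only [map_mul, map_inv, commutatorElement_def]; group
        _ = π T * ⁅π (a₀ ^ p ^ 1), π (b₀ ^ p ^ (n + 1))⁆ * (π T)⁻¹ := by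
            rw [show T⁻¹ * a₀ ^ p ^ 1 * T = a₀ ^ p ^ 1 by
              rw [← hTa 1, show T⁻¹ * (T * a₀ ^ p ^ 1 * T⁻¹) * T = a₀ ^ p ^ 1 by group, hTa 1]]
        _ = 1 := by rw [hc0, mul_one, mul_inv_cancel]
    rw [hveq, hRmul hu1 hγ' (mul_mem (mul_mem m1 m2) m3), (hcentralN γ hγ _).1, one_mul,
      hRmul hu1 (mul_mem m1 m2) m3, hRmul hu1 m1 m2, hRzpow hu1 (hHmem _) i, hRzpow hu1 (hEmem _) k,
      hRzpow hu1 (hFmem _) l, vH, vE, hc0, one_zpow, one_zpow, one_zpow, mul_one, mul_one]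
  -- (7) the other two layer-1 generators
  have hF1 : ∀ v ∈ Gamma (m' * p ^ (n + 1)), ⁅π (b₀ ^ p ^ 1), π v⁆ = 1 := by
    intro v hv
    have hSv : S⁻¹ * v * S ∈ Gamma (m' * p ^ (n + 1)) := by
      simpa using (Gamma_normal (m' * p ^ (n + 1))).conj_mem v hv S⁻¹
    calc ⁅π (b₀ ^ p ^ 1), π v⁆ = π S * ⁅π (a₀ ^ p ^ 1), π (S⁻¹ * v * S)⁆ * (π S)⁻¹ := by
          rw [← hSa 1]; simp only [map_mul, map_inv, commutatorElement_def]; group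
      _ = 1 := by rw [hE1 _ hSv, mul_one, mul_inv_cancel]
  have hH1 : ∀ v ∈ Gamma (m' * p ^ (n + 1)), ⁅π (T * b₀ ^ p ^ 1 * T⁻¹), π v⁆ = 1 := by
    intro v hv
    have hTv : T⁻¹ * v * T ∈ Gamma (m' * p ^ (n + 1)) := by
      simpa using (Gamma_normal (m' * p ^ (n + 1))).conj_mem v hv T⁻¹
    calc ⁅π (T * b₀ ^ p ^ 1 * T⁻¹), π v⁆ = π T * ⁅π (b₀ ^ p ^ 1), π (T⁻¹ * v * T)⁆ * (π T)⁻¹ := by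
          simp only [map_mul, map_inv, commutatorElement_def]; group
      _ = 1 := by rw [hF1 _ hTv, mul_one, mul_inv_cancel]
  -- (8) the layers `j + 2 ≥ 2` by downward induction
  have hdeep : ∀ d j : ℕ, j + 2 + d = n + 2 → ∀ u ∈ Gamma (m' * p ^ (j + 2)),
      ∀ v ∈ Gamma (m' * p ^ (n + 1)), ⁅π u, π v⁆ = 1 := by
    intro d
    induction d with
    | zero =>
      intro j hj u hu v hv
      have hj' : j + 2 = n + 2 := by omega
      rw [hj'] at hu
      exact (hcentralN u hu (π v)).2
    | succ d ih =>
      intro j hj u hu v hv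
      obtain ⟨i, k, l, γ, hγ, hueq⟩ := hNF (j + 2) (by omega) u hu
      have hγ' : ⁅π γ, π v⁆ = 1 := ih (j + 1) (by omega) γ hγ v hv
      have hjp : 1 ≤ j + 1 := by omega
      have pE : a₀ ^ p ^ (j + 1) ∈ Gamma p := hΓp hjp (hEmem _)
      have pF : b₀ ^ p ^ (j + 1) ∈ Gamma p := hΓp hjp (hFmem _)
      have pH : T * b₀ ^ p ^ (j + 1) * T⁻¹ ∈ Gamma p := hΓp hjp (hHmem _)
      have gE : ⁅π (a₀ ^ p ^ (j + 2)), π v⁆ = 1 := by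
        rw [show j + 2 = j + 1 + 1 by ring, hEpow (j + 1), hLpow pE hv, hptors pE hv]
      have gF : ⁅π (b₀ ^ p ^ (j + 2)), π v⁆ = 1 := by
        rw [show j + 2 = j + 1 + 1 by ring, hFpow (j + 1), hLpow pF hv, hptors pF hv]
      have gH : ⁅π (T * b₀ ^ p ^ (j + 2) * T⁻¹), π v⁆ = 1 := by
        rw [show j + 2 = j + 1 + 1 by ring, hHpow (j + 1), hLpow pH hv, hptors pH hv]
      have hj2 : 1 ≤ j + 2 := by omega
      have qγ : γ ∈ Gamma p := hΓp (by omega : 1 ≤ j + 2 + 1) hγ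
      have q1 : (T * b₀ ^ p ^ (j + 2) * T⁻¹) ^ i ∈ Gamma p := zpow_mem (hΓp hj2 (hHmem _)) i
      have q2 : (a₀ ^ p ^ (j + 2)) ^ k ∈ Gamma p := zpow_mem (hΓp hj2 (hEmem _)) k
      have q3 : (b₀ ^ p ^ (j + 2)) ^ l ∈ Gamma p := zpow_mem (hΓp hj2 (hFmem _)) l
      rw [hueq, hLmul qγ (mul_mem (mul_mem q1 q2) q3) hv, hγ', one_mul, hLmul (mul_mem q1 q2) q3 hv,
        hLmul q1 q2 hv, hLzpow (hΓp hj2 (hHmem _)) hv i, hLzpow (hΓp hj2 (hEmem _)) hv k,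
        hLzpow (hΓp hj2 (hFmem _)) hv l, gH, gE, gF, one_zpow, one_zpow, one_zpow, mul_one, mul_one]
  -- (9) layer `1`
  have hL1 : ∀ u ∈ Gamma (m' * p ^ 1), ∀ v ∈ Gamma (m' * p ^ (n + 1)), ⁅π u, π v⁆ = 1 := by
    intro u hu v hv
    obtain ⟨i, k, l, γ, hγ, hueq⟩ := hNF 1 le_rfl u hu
    have hγ' : ⁅π γ, π v⁆ = 1 := hdeep n 0 (by omega) γ hγ v hv
    have qγ : γ ∈ Gamma p := hΓp (by omega : 1 ≤ 1 + 1) hγ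
    have q1 : (T * b₀ ^ p ^ 1 * T⁻¹) ^ i ∈ Gamma p := zpow_mem (hΓp le_rfl (hHmem _)) i
    have q2 : (a₀ ^ p ^ 1) ^ k ∈ Gamma p := zpow_mem (hΓp le_rfl (hEmem _)) k
    have q3 : (b₀ ^ p ^ 1) ^ l ∈ Gamma p := zpow_mem (hΓp le_rfl (hFmem _)) l
    rw [hueq, hLmul qγ (mul_mem (mul_mem q1 q2) q3) hv, hγ', one_mul, hLmul (mul_mem q1 q2) q3 hv,
      hLmul q1 q2 hv, hLzpow (hΓp le_rfl (hHmem _)) hv i, hLzpow (hΓp le_rfl (hEmem _)) hv k,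
      hLzpow (hΓp le_rfl (hFmem _)) hv l, hH1 v hv, hE1 v hv, hF1 v hv, one_zpow, one_zpow, one_zpow,
      mul_one, mul_one]
  -- (10) general `x ∈ Γ(p) = Γ(m'p) Γ(p^{n+2})`
  have hmm2 : m'.Coprime (p ^ (n + 2)) := Nat.Coprime.pow_right _ hmm
  obtain ⟨c, hcm', hc⟩ := exists_mem_Gamma_map_eq hmm2
    (Matrix.SpecialLinearGroup.map (Int.castRingHom (ZMod (p ^ (n + 2)))) x)
  have hcx : c⁻¹ * x ∈ Gamma (p ^ (n + 2)) := by
    rw [Gamma_mem', map_mul, map_inv, hc, inv_mul_cancel]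
  have hcxp : c⁻¹ * x ∈ Gamma p := Gamma_le_Gamma_of_dvd₁₀ (dvd_pow_self p (by omega)) hcx
  have hcp : c ∈ Gamma p := by
    have h := mul_mem hx (inv_mem hcxp)
    rwa [show x * (c⁻¹ * x)⁻¹ = c by group] at h
  have hc1 : c ∈ Gamma (m' * p ^ 1) := by
    rw [pow_one]; exact mem_Gamma_mul_of_coprime hmm hcm' hcp
  have hcross : ⁅π (c⁻¹ * x), π y⁆ = 1 := by
    have h := map_commutatorElement_eq_one hmm2 θ hθ (hΓm' (n + 1) hy) hcx
    have h2 : π ⁅y, c⁻¹ * x⁆ = 1 := by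
      rw [hπ, QuotientGroup.mk'_apply, QuotientGroup.eq_one_iff]
      exact (mem_ker_map_subtype_iff θ).mpr ⟨_, h⟩
    rw [map_commutatorElement] at h2
    rw [← commutatorElement_inv, h2, inv_one]
  have hfinal : ⁅π x, π y⁆ = 1 := by
    rw [show x = c * (c⁻¹ * x) by group, hLmul hcp hcxp hy, hL1 c hc1 y hy, hcross, one_mul]
  apply hπone
  rw [map_commutatorElement, hfinal]

end UnboundedDenominators

end Literature.NumberTheory.Automorphic
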